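import Summits.HodgeConjecture.HodgeConjecture.Theorems.Ring2AbelianAllWeilSquarefreeRungs
import Literature.AlgebraicGeometry.HodgeTheory.HodgeClassesIsogenyInvariance
import Literature.AlgebraicGeometry.Motives.AbelianVarietyIsogenyPairFlip
import HarnessLib

/-!
# Ring 2 · AbelianAll (ab-weil-1, gen 5), part A — hyperbolic Weil type along the descent isogeny;
  squarefree discriminants suffice on the hyperbolic (split) slices, modulo one print fact

research route, not a corollary; conditional on HC_CM plus one named minimal statement.
Cell line: research route conditional on HC_CM; not a corollary; Q11.4-sentence-2 already refuted in dim ≥ 3.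
`HC_CM` (`Theses.RankFourFaces.CMAbelianHodge`) does not occur in this file. No case of the Hodge
conjecture is claimed: every statement below is an IMPLICATION or EQUIVALENCE between open
statements, unconditionally or under the typed print obligation `HyperplanePullbackAlongIsogeny`
(a HYPOTHESIS, never asserted). Part B (`Ring2AbelianAllWeilHyperbolicRungs`) applies this file to the
named rungs `SplitEightfolds`, `SplitWeilAbelianVarieties`, `NonsplitSixfolds`, Markman's split sixfolds.

File C of gen 4 (`Ring2AbelianAllWeilSquarefreeRungs`) re-indexed the Weil statements WITHOUT a
polarization (`WeilAlgebraicAll n d`, R∞, W₆, F1) by squarefree `d`, and recorded that the HYPERBOLIC /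
NON-SPLIT rungs were not covered, because their hypotheses name a polarization class through
`Motives.IsHyperbolicWeilType`, whose behaviour along the descent isogeny `A → B = A/φ'(A[m])` of file A
(`exists_isogeny_sq_descent`) was not proved. This file proves it:

* `isHyperbolicWeilType_comap_of_comm` — **hyperbolic Weil type pulls back along every `K`-equivariant
  homomorphism injective on `H¹`** (`g ≫ φ = ψ ≫ g`): the frame `u ↦ g^*u` stays rational, independent,
  stable and isotropic (`Q_{g^*h}(g^*x, g^*y) = g^* Q_h(x, y)`), and
  `isHyperbolicWeilType_iff_of_isIsogeny` — **it is an INVARIANT of `K`-equivariant isogenies**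
  (`(A, φ, h)` hyperbolic iff `(B, ψ, g^*h)` is; the quasi-inverse is equivariant by torsion-freeness of
  `Hom`): van Geemen's "`det H` is an isogeny invariant" (Lemma 5.2 (3)) for the class `(-1)ⁿ`, on carriers;
* `isHyperbolicWeilType_natCast_zsmul_iff` — `(B, mψ, h)` hyperbolic iff `(B, ψ, h)` (`m ≥ 1`), and
  `symmetrised_natCast_zsmul` — the `K`-symmetrised class of `(mψ, m²d)` is `m²` times that of `(ψ, d)`;
* `exists_isogeny_sq_descent'` — file A's descent datum completed: `f` is an isogeny too, `f ∘ p = [m]`,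
  `p ∘ f = [m]`, `f` intertwines `φ'` with `mψ` AND `p` intertwines `mψ` with `φ'`;
  `weilAlgebraicFor_of_descent` — file B's transport of Weil classes along the datum, as a lemma;
* DOWNWARD, free: `weilAlgebraicSplitHyperplane_of_sq_mul` — the `(n, m²d)` hyperbolic slice
  `WeilAlgebraicSplitHyperplane` implies the `(n, d)` one (same variety, `φ ↦ mφ`);
* UPWARD, modulo `HyperplanePullbackAlongIsogeny` (Hartshorne II 7.6, III Ex. 5.7 (d), App. A (C1)–(C2):
  along an isogeny `f : B → A` the pull-back of a hyperplane class of `A` is a non-zero rational multiple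
  of a hyperplane class of `B`; TRUE IN PRINT, not formalised, kept as a hypothesis):
  `weilAlgebraicSplitHyperplane_sq_mul`, and `forall_weilAlgebraicSplitHyperplane_iff_squarefree`.

## References
* B. van Geemen, *An introduction to the Hodge conjecture for abelian varieties*, LNM 1594 (1994),
  Lemma 5.2 (2)–(3), 5.4. [vanGeemen1994HodgeAV]
* D. Mumford, *Abelian Varieties* (1970), §7 Thm. 4 p. 72, §19 Thm. 3 and Remark p. 169. [MumfordAV1970]
* R. Hartshorne, *Algebraic Geometry* (1977), II Thm. 7.6, III Ex. 5.7 (d), App. A §3 (C1)–(C2). [Hartshorne1977]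
* B. Moonen, Yu. Zarhin, *Weil classes on abelian varieties*, Crelle 496 (1998), §1. [MoonenZarhin1998WeilClasses]
-/

noncomputable section

set_option linter.dupNamespace false

open CategoryTheory
open Literature.AlgebraicGeometry Literature.AlgebraicGeometry.Motives
open Literature.AlgebraicGeometry.HodgeTheory
open Literature.AlgebraicTopology.SingularHomology
open Summit.HodgeConjecture.HodgeConjecture.Cruxes.HodgeAbelianVarieties.EStepSecantInduction
open Summit.HodgeConjecture.HodgeConjecture.WeilTypeLadder

namespace Summit.HodgeConjecture.HodgeConjecture.Ring2.AbelianAll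

/-! ### Pull-backs along homomorphisms: bookkeeping -/

/-- `u^*(v^* c) = (u ≫ v)^* c` in the `complexBetti.map` spelling. [folklore] -/
theorem map_map_hom_apply {A B C : AbelianVariety ℂ} (u : A ⟶ B) (v : B ⟶ C) {k : ℕ}
    (c : complexBetti C.X k) :
    complexBetti.map u.hom.hom.hom k (complexBetti.map v.hom.hom.hom k c) =
      complexBetti.map (u ≫ v).hom.hom.hom k c := by
  rw [complexBetti_map_comp_hom, CategoryTheory.comp_apply]

/-- **`(m u)^* = mᵏ · u^*` on `Hᵏ`** for a homomorphism `u : B → C` and `m : ℕ`: `m u = [m]_C ∘ u` and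
`[m]_C^* = mᵏ` on `Hᵏ(C)` (Mumford §19). [cite: MumfordAV1970, §1 (3) and §19] -/
theorem complexBetti_map_natCast_zsmul_apply {B C : AbelianVariety ℂ} (u : B ⟶ C) (m k : ℕ)
    (y : complexBetti C.X k) :
    complexBetti.map ((m : ℤ) • u).hom.hom.hom k y = ((m : ℂ) ^ k) • complexBetti.map u.hom.hom.hom k y := by
  have h : ((m : ℤ) • u) = u ≫ (m • 𝟙 C) := by
    rw [natCast_zsmul, Preadditive.comp_nsmul, Category.comp_id]
  rw [h, ← map_map_hom_apply, complexBetti_map_nsmul_id_apply, map_smul]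

/-- **A `K`-equivariant homomorphism maps symmetrised classes to symmetrised classes**: for `g : B → A`
with `g ≫ φ = ψ ≫ g`, `g^*(D·y + φ^*y) = D·g^*y + ψ^*(g^*y)`. [cite: vanGeemen1994HodgeAV, 3.6] -/
theorem map_symmetrised_of_comm {A B : AbelianVariety ℂ} {φ : A ⟶ A} {ψ : B ⟶ B} (g : B ⟶ A)
    (hg : g ≫ φ = ψ ≫ g) (D : ℂ) (y : complexBetti A.X 2) :
    complexBetti.map g.hom.hom.hom 2 (D • y + complexBetti.map φ.hom.hom.hom 2 y) =
      D • complexBetti.map g.hom.hom.hom 2 y +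
        complexBetti.map ψ.hom.hom.hom 2 (complexBetti.map g.hom.hom.hom 2 y) := by
  rw [map_add, map_smul, map_map_hom_apply, hg, ← map_map_hom_apply]

/-- **The symmetrised class of `(mψ, m²d)` is `m²` times that of `(ψ, d)`**:
`m²d·y + (mψ)^*y = m²·(d·y + ψ^*y)` on `H²`. [cite: MumfordAV1970, §19] -/
theorem symmetrised_natCast_zsmul {B : AbelianVariety ℂ} (ψ : B ⟶ B) (m d : ℕ)
    (y : complexBetti B.X 2) :
    ((m ^ 2 * d : ℕ) : ℂ) • y + complexBetti.map ((m : ℤ) • ψ).hom.hom.hom 2 y =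
      ((m : ℂ) ^ 2) • ((d : ℂ) • y + complexBetti.map ψ.hom.hom.hom 2 y) := by
  rw [complexBetti_map_natCast_zsmul_apply, smul_add, smul_smul, Nat.cast_mul, Nat.cast_pow]

/-! ### Hyperbolic Weil type along equivariant homomorphisms and isogenies -/

/-- **Hyperbolic Weil type pulls back along a `K`-equivariant homomorphism injective on `H¹`.** For
`g : B → A` with `g ≫ φ = ψ ≫ g` and `g^* : H¹(A) → H¹(B)` injective (e.g. `g` an isogeny), if
`(A, φ)` is of hyperbolic Weil type in half-dimension `n` for the class `h`, then `(B, ψ)` is for `g^*h`: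
the frame `g^*u₁, …, g^*u₂ₙ` is rational, independent, `ψ^*`-stable (`ψ^* g^* = g^* φ^*`) and isotropic
(`Q_{g^*h}(g^*x, g^*y) = g^* Q_h(x, y)`, `g^*` a ring map). [cite: vanGeemen1994HodgeAV, Lemma 5.2 (3) and 5.4] -/
theorem isHyperbolicWeilType_comap_of_comm {A B : AbelianVariety ℂ} {φ : A ⟶ A} {ψ : B ⟶ B}
    (g : B ⟶ A) (hg : g ≫ φ = ψ ≫ g)
    (hinj : Function.Injective (complexBetti.map g.hom.hom.hom 1)) {n : ℕ} {h : complexBetti A.X 2}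
    (hA : IsHyperbolicWeilType A φ n h) :
    IsHyperbolicWeilType B ψ n (complexBetti.map g.hom.hom.hom 2 h) := by
  obtain ⟨u, hrat, hind, hstab, hiso⟩ := hA
  refine ⟨fun i => complexBetti.map g.hom.hom.hom 1 (u i), fun i => ?_, ?_, fun i => ?_, fun i j => ?_⟩
  · exact isRationalClass_complexBetti_map g.hom.hom.hom (hrat i)
  · exact hind.map_injOn (complexBetti.map g.hom.hom.hom 1).hom hinj.injOn
  · have key : complexBetti.map ψ.hom.hom.hom 1 (complexBetti.map g.hom.hom.hom 1 (u i)) =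
        complexBetti.map g.hom.hom.hom 1 (complexBetti.map φ.hom.hom.hom 1 (u i)) := by
      rw [map_map_hom_apply, map_map_hom_apply, hg]
    have hrange : Set.range (fun i => complexBetti.map g.hom.hom.hom 1 (u i)) =
        (complexBetti.map g.hom.hom.hom 1).hom '' Set.range u := Set.range_comp _ u
    rw [key, hrange, Submodule.span_image]
    exact Submodule.mem_map_of_mem (hstab i)
  · rw [← map_polarizationPairingOne, hiso i j, map_zero]

/-- **The quasi-inverse of a `K`-equivariant isogeny is `K`-equivariant**: if `g : B → A` intertwines
`ψ` and `φ` and `g ∘ g' = [N]_A`, `g' ∘ g = [N]_B` (`N ≥ 1`), then `g'` intertwines `φ` and `ψ`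
(`N·(g' ≫ ψ) = N·(φ ≫ g')` and `Hom` is torsion free, Mumford §19 Thm. 3). [cite: MumfordAV1970, §19 Thm. 3] -/
theorem comm_of_nsmul_inverse {A B : AbelianVariety ℂ} {φ : A ⟶ A} {ψ : B ⟶ B} {g : B ⟶ A}
    {g' : A ⟶ B} (hg : g ≫ φ = ψ ≫ g) {N : ℕ} (hN : N ≠ 0) (hgg' : g ≫ g' = N • 𝟙 B)
    (hg'g : g' ≫ g = N • 𝟙 A) : g' ≫ ψ = φ ≫ g' := by
  refine AbelianVariety.eq_of_nsmul_eq_nsmul (m := N) (by exact_mod_cast hN) ?_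
  calc N • (g' ≫ ψ) = (g' ≫ ψ) ≫ (g ≫ g') := by
        rw [hgg', Preadditive.comp_nsmul, Category.comp_id]
    _ = g' ≫ (ψ ≫ g) ≫ g' := by simp only [Category.assoc]
    _ = g' ≫ (g ≫ φ) ≫ g' := by rw [hg]
    _ = (g' ≫ g) ≫ (φ ≫ g') := by simp only [Category.assoc]
    _ = N • (φ ≫ g') := by rw [hg'g, Preadditive.nsmul_comp, Category.id_comp]

/-- **Hyperbolic Weil type is an invariant of `K`-equivariant isogenies** (van Geemen, Lemma 5.2 (3):
"`det Ψ ∈ ℚ^*/Nm(K^*)` … is an isogeny invariant", here for the class `(-1)ⁿ` = hyperbolic, on the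
carriers). For an isogeny `g : B → A` with `g ≫ φ = ψ ≫ g`: `(A, φ, h)` is of hyperbolic Weil type iff
`(B, ψ, g^*h)` is. (`→`: `isHyperbolicWeilType_comap_of_comm`, `g^*` injective; `←`: pull back along the
equivariant quasi-inverse `g'`, `g'^* g^* h = N²·h`, and rescale.)
[cite: vanGeemen1994HodgeAV, Lemma 5.2 (3) and 5.4] [cite: MumfordAV1970, §19 Remark p. 169] -/
theorem isHyperbolicWeilType_iff_of_isIsogeny {A B : AbelianVariety ℂ} {φ : A ⟶ A} {ψ : B ⟶ B}
    {g : B ⟶ A} (hgi : AbelianVariety.IsIsogeny g) (hg : g ≫ φ = ψ ≫ g) {n : ℕ}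
    {h : complexBetti A.X 2} :
    IsHyperbolicWeilType A φ n h ↔ IsHyperbolicWeilType B ψ n (complexBetti.map g.hom.hom.hom 2 h) := by
  refine ⟨isHyperbolicWeilType_comap_of_comm g hg (complexBetti_map_bijective_of_isIsogeny hgi 1).1,
    fun hB => ?_⟩
  obtain ⟨g', N, hN, hgg', hg'g⟩ := AbelianVariety.IsIsogeny.exists_nsmul_inverse_holds hgi
  have hcomm : g' ≫ ψ = φ ≫ g' := comm_of_nsmul_inverse hg hN.ne' hgg' hg'g
  have h' := isHyperbolicWeilType_comap_of_comm g' hcomm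
    (complexBetti_map_injective_of_comp_eq_nsmul_id hN.ne' hgg' 1) hB
  rw [complexBetti_map_map_of_comp_eq_nsmul_id hg'g] at h'
  exact (isHyperbolicWeilType_smul_iff (pow_ne_zero 2 (Nat.cast_ne_zero.mpr hN.ne'))).1 h'

/-- **`(B, mψ, h)` is of hyperbolic Weil type iff `(B, ψ, h)` is** (`m ≥ 1`): `(mψ)^* = m·ψ^*` on `H¹`,
and a subspace is `m·ψ^*`-stable iff `ψ^*`-stable. [cite: vanGeemen1994HodgeAV, Lemma 5.2 (2)] -/
theorem isHyperbolicWeilType_natCast_zsmul_iff {B : AbelianVariety ℂ} {ψ : B ⟶ B} {m : ℕ} (hm : m ≠ 0)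
    {n : ℕ} {h : complexBetti B.X 2} :
    IsHyperbolicWeilType B ((m : ℤ) • ψ) n h ↔ IsHyperbolicWeilType B ψ n h := by
  refine exists_congr fun u => and_congr_right fun _ => and_congr_right fun _ =>
    and_congr (forall_congr' fun i => ?_) Iff.rfl
  rw [complexBetti_map_natCast_zsmul_apply, pow_one,
    Submodule.smul_mem_iff _ (Nat.cast_ne_zero.mpr hm)]

/-! ### The descent datum of file A, completed -/

section Descent

variable {A : AbelianVariety ℂ}

/-- **The isogeny dividing `φ'` by `m`, with both intertwining relations.** If `φ'² = -m²d` on `A`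
(`m ≥ 1`) there are isogenies `p : A → B`, `f : B → A` with `f ∘ p = [m]_A`, `p ∘ f = [m]_B`, and
`ψ ∈ End B` with `ψ² = -d`, `f ∘ φ' = mψ ∘ f` and `p ∘ mψ = … = φ' ∘ p` (in diagram order:
`f ≫ φ' = mψ ≫ f`, `p ≫ mψ = φ' ≫ p`): file A's `exists_isogeny_sq_descent` plus `p` epi and
torsion-freeness of `Hom`. [cite: MumfordAV1970, §7 Thm. 4 p. 72 and §19 Thm. 3] -/
theorem exists_isogeny_sq_descent' {m d : ℕ} (hm : m ≠ 0) {φ' : A ⟶ A}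
    (hφ' : φ' ≫ φ' = -((m ^ 2 * d) • 𝟙 A)) :
    ∃ (B : AbelianVariety ℂ) (p : A ⟶ B) (f : B ⟶ A) (ψ : B ⟶ B),
      AbelianVariety.IsIsogeny p ∧ AbelianVariety.IsIsogeny f ∧
        p ≫ f = (m : ℤ) • 𝟙 A ∧ f ≫ p = (m : ℤ) • 𝟙 B ∧ ψ ≫ ψ = -(d • 𝟙 B) ∧
          f ≫ φ' = ((m : ℤ) • ψ) ≫ f ∧ p ≫ ((m : ℤ) • ψ) = φ' ≫ p := by
  obtain ⟨B, p, f, ψ, hp, hf, hψ, hfφ⟩ := exists_isogeny_sq_descent hm hφ'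
  have hmC : (m : ℂ) ≠ 0 := Nat.cast_ne_zero.mpr hm
  have hdim : A.dim = B.dim := AbelianVariety.dim_eq_of_isIsogenous_holds ⟨p, hp⟩
  have hfp : f ≫ p = (m : ℤ) • 𝟙 B := hp.cancel_left (by
    rw [← Category.assoc, hf, Preadditive.zsmul_comp, Preadditive.comp_zsmul, Category.id_comp,
      Category.comp_id])
  have hfi : AbelianVariety.IsIsogeny f :=
    AbelianVariety.isIsogeny_of_comp_eq_nsmul_id (m := m) hmC (by rw [hfp, natCast_zsmul]) hdim.symm
  have hpψ : p ≫ ((m : ℤ) • ψ) = φ' ≫ p := zsmul_left_cancel hm (by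
    calc (m : ℤ) • (p ≫ ((m : ℤ) • ψ)) = (p ≫ ((m : ℤ) • ψ)) ≫ (f ≫ p) := by
          simp only [hfp, Preadditive.comp_zsmul, Category.comp_id]
      _ = p ≫ (((m : ℤ) • ψ) ≫ f) ≫ p := by simp only [Category.assoc]
      _ = p ≫ (f ≫ φ') ≫ p := by rw [hfφ]
      _ = (p ≫ f) ≫ (φ' ≫ p) := by simp only [Category.assoc]
      _ = (m : ℤ) • (φ' ≫ p) := by rw [hf, Preadditive.zsmul_comp, Category.id_comp])
  exact ⟨B, p, f, ψ, hp, hfi, hf, hfp, hψ, hfφ, hpψ⟩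

/-- **Weil classes of `(A, φ', m²d)` from those of `(B, ψ, d)` along the descent datum** (the second
half of file B's `weilAlgebraicAll_sq_mul`, as a lemma): a rational `(n,n)` Weil class of `(A, φ')`
pulls back along `f` into the Weil plane of `(B, mψ, m²d) = (B, ψ, d)`, and back along the flat
isogeny `p` to `m²ⁿ` times itself. [cite: MoonenZarhin1998WeilClasses, §1] [cite: MumfordAV1970, §19] -/
theorem weilAlgebraicFor_of_descent {n m d : ℕ} (hm : m ≠ 0) (hd : d ≠ 0) {φ' : A ⟶ A}
    (hA : A.dim = 2 * n) {B : AbelianVariety ℂ} {p : A ⟶ B} {f : B ⟶ A} {ψ : B ⟶ B}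
    (hp : AbelianVariety.IsIsogeny p) (hf : p ≫ f = (m : ℤ) • 𝟙 A) (hψ : ψ ≫ ψ = -(d • 𝟙 B))
    (hfφ : f ≫ φ' = ((m : ℤ) • ψ) ≫ f) (hW : WeilAlgebraicFor n d B ψ) :
    WeilAlgebraicFor n (m ^ 2 * d) A φ' := by
  intro c' hc' hrat hhodge
  have hB : B.dim = 2 * n := (AbelianVariety.dim_eq_of_isIsogenous_holds ⟨p, hp⟩).symm.trans hA
  have hc₁W : complexBetti.map f.hom.hom.hom (2 * n) c' ∈ weilClassesOf B ψ n d := by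
    rw [← weilClassesOf_zsmul_sq_mul hm hd hψ]
    exact map_mem_weilClassesOf_of_comm f hfφ hc'
  have hc₁alg : complexBetti.map f.hom.hom.hom (2 * n) c' ∈ algebraicClasses B.X n :=
    hW _ hc₁W (isRationalClass_complexBetti_map f.hom.hom.hom hrat)
      (hhodge.map_of_isSmoothProjective (isSmoothProjective_of_dim_eq' hB)
        (isSmoothProjective_of_dim_eq' hA) f.hom.hom.hom)
  haveI : AlgebraicGeometry.Flat (AbelianVariety.Hom.toSchemeHom p) := hp.flat
  have hc₂alg := map_mem_algebraicClasses_of_flat p.hom.hom.hom hc₁alg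
  have hkey : complexBetti.map p.hom.hom.hom (2 * n) (complexBetti.map f.hom.hom.hom (2 * n) c') =
      ((m : ℂ) ^ (2 * n)) • c' := by
    rw [map_map_hom_apply, hf]
    exact map_zsmul_id_of_mem_weilClassesOf m hc'
  rw [hkey] at hc₂alg
  have hmn : ((m : ℂ) ^ (2 * n)) ≠ 0 := pow_ne_zero _ (Nat.cast_ne_zero.mpr hm)
  have h' := (algebraicClasses A.X n).smul_mem (((m : ℂ) ^ (2 * n))⁻¹) hc₂alg
  rwa [smul_smul, inv_mul_cancel₀ hmn, one_smul] at h'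

end Descent

/-! ### The one print obligation -/

/-- **`HyperplanePullbackAlongIsogeny` — along an isogeny, the pull-back of a hyperplane class is a
non-zero rational multiple of a hyperplane class (a THEOREM IN PRINT; kept as a named hypothesis because
its carrier rendering — first Chern classes of line bundles in `H²(–(ℂ); ℂ)`, `H²(ℙᴺ; ℚ) = ℚ·[H]`, and
very ampleness of a power of an ample sheaf — is not proved in the tree; never cited as a fact).** For an
isogeny `f : B → A` of complex abelian varieties, a projective embedding `e : A ↪ ℙᴺ` and a non-zero
rational `a ∈ H²(ℙᴺ(ℂ); ℂ)` (so `e^*a = q·c₁(𝒪_A(1))`, `q ∈ ℚ^×`), there are a projective embedding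
`e' : B ↪ ℙ^{N'}`, a non-zero rational `a' ∈ H²(ℙ^{N'}(ℂ); ℂ)` and `c ∈ ℚ^×` with
`e'^*a' = c · f^*(e^*a)` in `H²(B(ℂ); ℂ)`. In print: `f` is finite, so `f^*𝒪_A(1)` is ample
(Hartshorne III Ex. 5.7 (d)); some power `(f^*𝒪_A(1))^{⊗k}` is very ample (II Thm. 7.6) and embeds `B`
with `e'^*𝒪(1) = (f^*𝒪_A(1))^{⊗k}`, whence `e'^*[H'] = k·f^*c₁(𝒪_A(1)) = (k/q)·f^*(e^*a)` (App. A §3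
(C1)–(C2)). OPEN as a formal statement of the tree (obligation node, provable by name by a Literature
seat); NOT asserted. [cite: Hartshorne1977, II Thm. 7.6, III Ex. 5.7 (d) and App. A §3 (C1)–(C2)]
[cite: MumfordAV1970, §6 Application 1 p. 62] [status: open] -/
@[conjecture] def HyperplanePullbackAlongIsogeny : Prop :=
  ∀ (A B : AbelianVariety ℂ) (f : B ⟶ A), AbelianVariety.IsIsogeny f →
    ∀ (e : ProjectiveEmbedding A.X) (a : complexBetti (projectiveSpace e.n ℂ) 2),
      IsRationalClass a → a ≠ 0 →
        ∃ (e' : ProjectiveEmbedding B.X) (a' : complexBetti (projectiveSpace e'.n ℂ) 2) (c : ℚ),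
          IsRationalClass a' ∧ a' ≠ 0 ∧ c ≠ 0 ∧
            complexBetti.map e'.ι 2 a' =
              (c : ℂ) • complexBetti.map f.hom.hom.hom 2 (complexBetti.map e.ι 2 a)

/-! ### The hyperbolic (split) slices: `WeilAlgebraicSplitHyperplane n d` -/

/-- **DOWNWARD, free: the split slice at `(n, m²d)` implies the split slice at `(n, d)`** (`m ≥ 1`). On
the SAME variety: `(A, φ, d)` with `φ² = -d`, hyperbolic for `d·e^*a + φ^*e^*a`, is `(A, mφ, m²d)`,
hyperbolic for `m²d·e^*a + (mφ)^*e^*a = m²·(d·e^*a + φ^*e^*a)`, with the same Weil plane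
(`weilClassesOf_zsmul_sq_mul`). [cite: MoonenZarhin1998WeilClasses, §1] [cite: vanGeemen1994HodgeAV, 5.2] -/
theorem weilAlgebraicSplitHyperplane_of_sq_mul {n m d : ℕ} (hm : m ≠ 0)
    (hW : Stubs.WeilAlgebraicSplitHyperplane n (m ^ 2 * d)) :
    Stubs.WeilAlgebraicSplitHyperplane n d := by
  rcases Nat.eq_zero_or_pos d with rfl | hd
  · simpa using hW
  intro A φ e a hA hφ ha ha0 hhyp c hcW hrat hhodge
  have hφ' : ((m : ℤ) • φ) ≫ ((m : ℤ) • φ) = -((m ^ 2 * d) • 𝟙 A) := by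
    rw [Preadditive.zsmul_comp, Preadditive.comp_zsmul, hφ, natCast_zsmul, natCast_zsmul, smul_neg,
      smul_neg, smul_smul, smul_smul, show m * m * d = m ^ 2 * d by ring]
  have hhyp' : IsHyperbolicWeilType A ((m : ℤ) • φ) n
      (((m ^ 2 * d : ℕ) : ℂ) • complexBetti.map e.ι 2 a +
        complexBetti.map ((m : ℤ) • φ).hom.hom.hom 2 (complexBetti.map e.ι 2 a)) := by
    rw [symmetrised_natCast_zsmul,
      isHyperbolicWeilType_smul_iff (pow_ne_zero 2 (Nat.cast_ne_zero.mpr hm)),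
      isHyperbolicWeilType_natCast_zsmul_iff hm]
    exact hhyp
  exact hW A ((m : ℤ) • φ) e a hA hφ' ha ha0 hhyp' c
    (by rwa [weilClassesOf_zsmul_sq_mul hm hd.ne' hφ]) hrat hhodge

/-- **UPWARD, modulo the print obligation: the split slice at `(n, d)` implies the split slice at
`(n, m²d)`** (`m ≥ 1`). Given `(A, φ', m²d)` hyperbolic for `h = m²d·e^*a + φ'^*e^*a`, descend to
`(B, ψ, d)` (`exists_isogeny_sq_descent'`): `(B, ψ)` is hyperbolic for `f^*h = m²·(d·y + ψ^*y)`,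
`y = f^*e^*a` (`isHyperbolicWeilType_comap_of_comm`), hence for `d·e'^*a' + ψ^*e'^*a'` where
`e'^*a' = c·y` is the hyperplane class of `B` supplied by `HyperplanePullbackAlongIsogeny`; the slice at
`(n, d)` makes the Weil classes of `(B, ψ)` algebraic, and `weilAlgebraicFor_of_descent` brings them back
to `A`. [cite: vanGeemen1994HodgeAV, Lemma 5.2 (3)] [cite: Hartshorne1977, III Ex. 5.7 (d)]
[cite: MumfordAV1970, §7 Thm. 4 p. 72] -/
theorem weilAlgebraicSplitHyperplane_sq_mul (H : HyperplanePullbackAlongIsogeny) {n m d : ℕ}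
    (hm : m ≠ 0) (hW : Stubs.WeilAlgebraicSplitHyperplane n d) :
    Stubs.WeilAlgebraicSplitHyperplane n (m ^ 2 * d) := by
  rcases Nat.eq_zero_or_pos d with rfl | hd
  · simpa using hW
  intro A φ' e a hA hφ' ha ha0 hhyp c' hc'W hrat hhodge
  obtain ⟨B, p, f, ψ, hp, hfi, hf, -, hψ, hfφ, -⟩ := exists_isogeny_sq_descent' hm hφ'
  have hB : B.dim = 2 * n := (AbelianVariety.dim_eq_of_isIsogenous_holds ⟨p, hp⟩).symm.trans hA
  -- `(B, ψ)` is hyperbolic for `d·y + ψ^*y`, `y = f^*e^*a`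
  have h₁ := (isHyperbolicWeilType_iff_of_isIsogeny hfi hfφ).1 hhyp
  rw [map_symmetrised_of_comm f hfφ, symmetrised_natCast_zsmul,
    isHyperbolicWeilType_smul_iff (pow_ne_zero 2 (Nat.cast_ne_zero.mpr hm)),
    isHyperbolicWeilType_natCast_zsmul_iff hm] at h₁
  -- the hyperplane class `e'^*a' = c·y` of `B`
  obtain ⟨e', a', c, ha', ha'0, hc, he'⟩ := H A B f hfi e a ha ha0
  have h₂ : IsHyperbolicWeilType B ψ n ((d : ℂ) • complexBetti.map e'.ι 2 a' +
      complexBetti.map ψ.hom.hom.hom 2 (complexBetti.map e'.ι 2 a')) := by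
    rw [he', map_smul, smul_comm (d : ℂ) (c : ℂ), ← smul_add]
    exact (isHyperbolicWeilType_smul_iff (by exact_mod_cast hc)).2 h₁
  exact weilAlgebraicFor_of_descent hm hd.ne' hA hp hf hψ hfφ (hW B ψ e' a' hB hψ ha' ha'0 h₂)
    c' hc'W hrat hhodge

/-- **Squarefree `d` suffice on the split slices, modulo the print obligation**:
`(∀ d ≥ 1, WeilAlgebraicSplitHyperplane n d) ↔ (∀ squarefree d ≥ 1, …)` (`d = b²a`).
[cite: MoonenZarhin1998WeilClasses, §1] -/
theorem forall_weilAlgebraicSplitHyperplane_iff_squarefree (H : HyperplanePullbackAlongIsogeny) (n : ℕ) :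
    (∀ d : ℕ, 0 < d → Stubs.WeilAlgebraicSplitHyperplane n d) ↔
      ∀ d : ℕ, 0 < d → Squarefree d → Stubs.WeilAlgebraicSplitHyperplane n d := by
  refine ⟨fun h d hd _ => h d hd, fun h d hd => ?_⟩
  obtain ⟨a, b, ha, hb, rfl, hsq⟩ := Nat.sq_mul_squarefree_of_pos hd
  exact weilAlgebraicSplitHyperplane_sq_mul H hb.ne' (h a ha hsq)

/-- **One squarefree `d₀` governs its square class downward, free**: the split slice at `(n, b²d₀)`
gives the one at `(n, d₀)`; upward (`d₀ ⟹ b²d₀`) needs the print obligation. [cite: MoonenZarhin1998WeilClasses, §1] -/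
theorem weilAlgebraicSplitHyperplane_sq_class_iff (H : HyperplanePullbackAlongIsogeny) {n m d : ℕ}
    (hm : m ≠ 0) :
    Stubs.WeilAlgebraicSplitHyperplane n (m ^ 2 * d) ↔ Stubs.WeilAlgebraicSplitHyperplane n d :=
  ⟨weilAlgebraicSplitHyperplane_of_sq_mul hm, weilAlgebraicSplitHyperplane_sq_mul H hm⟩

end Summit.HodgeConjecture.HodgeConjecture.Ring2.AbelianAll

end
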